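/-
Copyright (c) 2026. All rights reserved.
Released under Apache 2.0 license as described in the file LICENSE.
Authors: abc-iut cell — seat abc-iut-w4-d104 (wave 4, D-0067; node AbsTopIII:Prop2.6 bridge to
[AbsTopIII] Prop 2.5 (e)). Proof-only companion to `HolomorphicCores`; no new definitions.
-/
import Literature.AnabelianGeometry.AbsoluteAnabelian.ParallelogramsLocalAddProofs
import HarnessLib

/-!
# [AbsTopIII] Prop 2.5 (e): existence of `a +_p b` near `p` and the parallelogram law, both ways

Sequel to `ParallelogramsLocalAddProofs.lean` (the direction "`LocalAdd ⇒ c = a + b − p`").  Here,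
for `U ⊆ ℂ` open, `𝒮(U) ⊆ 𝒬 ⊆ 𝒫(U)` and granted the Prop. 2.5 (c) reconstruction
`Parallelograms.parallelograms 𝒬 = {P | val '' P ∈ 𝒫(U)}` (first clause of `TwoOrientations`):

* `Parallelograms.localAdd_of_linearIndependent` — if `a − p`, `b − p` are `ℝ`-independent and the
  closed parallelogram with vertex `p` and edges to `a`, `b` lies in `U`, then
  `LocalAdd 𝒬 p a b c` holds for the fourth vertex `c = a + b − p` (the witnessing `P`, `S_a`, `S_b`
  of the printed construction are exhibited);
* `Parallelograms.exists_nhds_localAdd_iff` — **Prop 2.5 (e) as printed** ("`a +_p b` is defined for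
  `a, b` in some neighborhood of `p`"): there is `ε > 0` such that for `a, b` within `ε` of `p`,
  `a, b ≠ p`, the relation `LocalAdd 𝒬 p a b c` holds iff `a − p`, `b − p` are independent and
  `c = a + b − p`.

S. Mochizuki, *Topics in absolute anabelian geometry III*, Prop. 2.5 (e), kurims p. 57 (bib key
`MochizukiAbsTopIII2015`).  Refereed pre-IUT material; nothing here bears on the disputed
[IUTchIII] Cor. 3.12.  Consumer: the Prop. 2.6 germ-group model of seat abc-iut-w4-d104.
-/

namespace Literature.AnabelianGeometry.AbsoluteAnabelian

open _root_.Complex _root_.Set _root_.Topology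

noncomputable section

/-! ### Two independent edges from a common vertex meet only at the vertex -/

/-- If `v, w` are `ℝ`-independent then the segments `[p, p + v]` and `[p, p + w]` meet only at `p`.
(Auxiliary.) [cite: MochizukiAbsTopIII2015, Proposition 2.5 (proof) pp.55–57] -/
theorem segment_inter_segment_eq_of_linearIndependent {p v w : ℂ} (h : LinearIndependent ℝ ![v, w]) :
    segment ℝ p (p + v) ∩ segment ℝ p (p + w) = {p} := by
  ext x
  simp only [mem_inter_iff, mem_singleton_iff]
  constructor
  · rintro ⟨hx1, hx2⟩
    rw [segment_eq_image'] at hx1 hx2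
    obtain ⟨s, -, rfl⟩ := hx1
    obtain ⟨t, -, hst⟩ := hx2
    simp only [add_sub_cancel_left] at hst
    have h0 : s • v + (-t) • w = 0 := by
      rw [neg_smul]
      exact sub_eq_zero.2 ((add_right_inj p).1 hst.symm)
    have hs := ((LinearIndependent.pair_iff.1 h) s (-t) h0).1
    simp [hs]
  · rintro rfl
    exact ⟨left_mem_segment ℝ _ _, left_mem_segment ℝ _ _⟩

/-- The closed parallelogram with vertex `p` and edge vectors of length `< ε` lies in the ball of radius
`2ε` around `p`; hence, for `p` in an open `U`, small parallelograms at `p` have closure in `U`.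
(Auxiliary.) [cite: MochizukiAbsTopIII2015, Proposition 2.5 (e) p.57] -/
theorem exists_closure_openParallelogram_subset {U : Set ℂ} (hU : IsOpen U) {p : ℂ} (hp : p ∈ U) :
    ∃ ε > 0, ∀ v w : ℂ, ‖v‖ < ε → ‖w‖ < ε → LinearIndependent ℝ ![v, w] →
      closure (openParallelogram p v w) ⊆ U := by
  obtain ⟨δ, hδ, hball⟩ := Metric.isOpen_iff.1 hU p hp
  refine ⟨δ / 2, by positivity, fun v w hv hw hvw x hx => hball ?_⟩
  obtain ⟨s, t, hs0, hs1, ht0, ht1, rfl⟩ := (mem_closure_openParallelogram_iff hvw).1 hx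
  rw [Metric.mem_ball, dist_eq_norm, show p + (s : ℂ) * v + (t : ℂ) * w - p = (s : ℂ) * v + (t : ℂ) * w
    by ring]
  calc ‖(s : ℂ) * v + (t : ℂ) * w‖ ≤ ‖(s : ℂ) * v‖ + ‖(t : ℂ) * w‖ := norm_add_le _ _
    _ = s * ‖v‖ + t * ‖w‖ := by
        rw [norm_mul, norm_mul, Complex.norm_real, Complex.norm_real, Real.norm_of_nonneg hs0,
          Real.norm_of_nonneg ht0]
    _ ≤ 1 * ‖v‖ + 1 * ‖w‖ := by gcongr
    _ < δ / 2 + δ / 2 := by rw [one_mul, one_mul]; exact add_lt_add hv hw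
    _ = δ := by ring

section LocalAdd

variable {U : Set ℂ}

/-- **[AbsTopIII] Prop 2.5 (e), existence.** For `U ⊆ ℂ` open, `𝒮(U) ⊆ 𝒬 ⊆ 𝒫(U)`, granted the
Prop 2.5 (c) reconstruction: if `a − p`, `b − p` are `ℝ`-independent and the closed parallelogram
`P̄ = p + [0,1](a − p) + [0,1](b − p)` lies in `U`, then `a +_p b = a + b − p` in the sense of
`Parallelograms.LocalAdd` — witnessed, exactly as printed, by `P ∈ 𝒫(U)` with the intersecting sides
`S_a = [p, a]`, `S_b = [p, b]`, `S_a ∩ S_b = {p}`, `∂S_a = {p, a}`, `∂S_b = {p, b}`, the fourth vertex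
being the unique endpoint of a side of `P` outside `{a, b, p}`.
[cite: MochizukiAbsTopIII2015, Proposition 2.5 (e) p.57] -/
theorem Parallelograms.localAdd_of_linearIndependent (hU : IsOpen U) {𝒬 : Set (Set U)}
    (h𝒬 : ∀ Q ∈ 𝒬, Subtype.val '' Q ∈ parallelogramsIn U)
    (h𝒮 : ∀ Q : Set U, Subtype.val '' Q ∈ squaresIn U → Q ∈ 𝒬)
    (H : Parallelograms.parallelograms 𝒬 = {P : Set U | Subtype.val '' P ∈ parallelogramsIn U})
    {p a b c : U} (hind : LinearIndependent ℝ ![(a : ℂ) - p, (b : ℂ) - p])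
    (hcl : closure (openParallelogram (p : ℂ) (a - p) (b - p)) ⊆ U) (hc : (c : ℂ) = a + b - p) :
    Parallelograms.LocalAdd 𝒬 p a b c := by
  obtain ⟨h𝒬', h𝒮'⟩ := Parallelograms.hyps_of_parallelograms_eq H
  -- non-degeneracy consequences
  have hap : (a : ℂ) ≠ p := by
    intro h
    have := ((LinearIndependent.pair_iff.1 hind) 1 0 (by simp [h]))
    simp at this
  have hbp : (b : ℂ) ≠ p := by
    intro h
    have := ((LinearIndependent.pair_iff.1 hind) 0 1 (by simp [h]))
    simp at this
  have ha : a ≠ p := fun h => hap (congrArg Subtype.val h)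
  have hb : b ≠ p := fun h => hbp (congrArg Subtype.val h)
  -- the parallelogram `P` and its frame
  set v : ℂ := (a : ℂ) - p with hv
  set w : ℂ := (b : ℂ) - p with hw
  obtain ⟨A, hA⟩ := exists_homeomorph_frame (p : ℂ) v w hind
  have hPU : openParallelogram (p : ℂ) v w ⊆ U := subset_closure.trans hcl
  set P : Set U := Subtype.val ⁻¹' openParallelogram (p : ℂ) v w with hPdef
  have hPe : Subtype.val '' P = openParallelogram (p : ℂ) v w := by
    rw [hPdef, image_preimage_eq_inter_range, Subtype.range_coe, inter_eq_left.2 hPU]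
  have hP : P ∈ Parallelograms.parallelograms 𝒬 := by
    rw [H]
    exact ⟨p, v, w, hind, hPe, hPe ▸ hcl⟩
  have hside := fun S => Parallelograms.isSide_iff_of_subset hU h𝒬' h𝒮' hP hPe hind hcl hA (S := S)
  -- corners
  have hA00 : A ⟨0, 0⟩ = p := by rw [frame_apply_mk hA]; push_cast; ring
  have hA10 : A ⟨1, 0⟩ = a := by rw [frame_apply_mk hA, hv]; push_cast; ring
  have hA01 : A ⟨0, 1⟩ = b := by rw [frame_apply_mk hA, hw]; push_cast; ring
  have hA11 : A ⟨1, 1⟩ = c := by rw [frame_apply_mk hA, hc, hv, hw]; push_cast; ring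
  -- edges
  have hEa : A '' (Icc 0 1 ×ℂ {(0 : ℝ)}) = segment ℝ (p : ℂ) a := by
    rw [image_frame_Icc_const hA, hv]; push_cast
    rw [show (p : ℂ) + 0 * w = p by ring, show (p : ℂ) + ((a : ℂ) - p) = a by ring]
  have hEb : A '' ({(0 : ℝ)} ×ℂ Icc 0 1) = segment ℝ (p : ℂ) b := by
    rw [image_frame_const_Icc hA, hw]; push_cast
    rw [show (p : ℂ) + 0 * v = p by ring, show (p : ℂ) + ((b : ℂ) - p) = b by ring]
  have hEc : A '' (Icc 0 1 ×ℂ {(1 : ℝ)}) = segment ℝ (b : ℂ) c := by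
    rw [image_frame_Icc_const hA, hc, hv, hw]; push_cast
    rw [show (p : ℂ) + 1 * ((b : ℂ) - p) = b by ring,
      show (b : ℂ) + ((a : ℂ) - p) = a + b - p by ring]
  have hsegU : ∀ {x y : ℂ} {E : Set ℂ}, A '' E = segment ℝ x y →
      (E = Icc 0 1 ×ℂ {(0 : ℝ)} ∨ E = Icc 0 1 ×ℂ {(1 : ℝ)} ∨ E = {(0 : ℝ)} ×ℂ Icc 0 1 ∨
        E = {(1 : ℝ)} ×ℂ Icc 0 1) →
      Subtype.val '' (Subtype.val ⁻¹' (A '' E) : Set U) = segment ℝ x y := by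
    intro x y E hE hE'
    rw [image_preimage_eq_inter_range, Subtype.range_coe,
      inter_eq_left.2 (sq_edge_image_subset hind hcl hA hE'), hE]
  have hvala := hsegU hEa (Or.inl rfl)
  have hvalb := hsegU hEb (Or.inr (Or.inr (Or.inl rfl)))
  have hvalc := hsegU hEc (Or.inr (Or.inl rfl))
  -- endpoints of the three relevant sides
  have hcb : (c : ℂ) ≠ b := by
    rw [hc]
    intro h
    exact hap (by linear_combination h)
  have henda : Parallelograms.endpoints 𝒬 (Subtype.val ⁻¹' (A '' (Icc 0 1 ×ℂ {(0 : ℝ)})) : Set U) =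
      {p, a} := by
    rw [Parallelograms.endpoints_eq_of_subset hU h𝒬 h𝒮 hap.symm hvala]
    ext x
    simp only [mem_inter_iff, mem_preimage, mem_insert_iff, mem_singleton_iff]
    constructor
    · rintro ⟨-, h | h⟩
      · exact Or.inl (Subtype.ext h)
      · exact Or.inr (Subtype.ext h)
    · rintro (rfl | rfl)
      · exact ⟨by rw [hEa]; exact left_mem_segment ℝ _ _, Or.inl rfl⟩
      · exact ⟨by rw [hEa]; exact right_mem_segment ℝ _ _, Or.inr rfl⟩
  have hendb : Parallelograms.endpoints 𝒬 (Subtype.val ⁻¹' (A '' ({(0 : ℝ)} ×ℂ Icc 0 1)) : Set U) =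
      {p, b} := by
    rw [Parallelograms.endpoints_eq_of_subset hU h𝒬 h𝒮 hbp.symm hvalb]
    ext x
    simp only [mem_inter_iff, mem_preimage, mem_insert_iff, mem_singleton_iff]
    constructor
    · rintro ⟨-, h | h⟩
      · exact Or.inl (Subtype.ext h)
      · exact Or.inr (Subtype.ext h)
    · rintro (rfl | rfl)
      · exact ⟨by rw [hEb]; exact left_mem_segment ℝ _ _, Or.inl rfl⟩
      · exact ⟨by rw [hEb]; exact right_mem_segment ℝ _ _, Or.inr rfl⟩
  have hendc : c ∈ Parallelograms.endpoints 𝒬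
      (Subtype.val ⁻¹' (A '' (Icc 0 1 ×ℂ {(1 : ℝ)})) : Set U) := by
    rw [Parallelograms.endpoints_eq_of_subset hU h𝒬 h𝒮 hcb.symm hvalc]
    refine ⟨?_, Or.inr rfl⟩
    show (c : ℂ) ∈ A '' _
    rw [hEc]; exact right_mem_segment ℝ _ _
  -- assemble
  refine Or.inr (Or.inr ⟨ha, hb, P, hP, _, _, (hside _).2 ⟨_, Or.inl rfl, rfl⟩,
    (hside _).2 ⟨_, Or.inr (Or.inr (Or.inl rfl)), rfl⟩, ?_, henda, hendb, ?_,
    ⟨_, (hside _).2 ⟨_, Or.inr (Or.inl rfl), rfl⟩, hendc⟩, ?_⟩)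
  · -- `S_a ∩ S_b = {p}`
    ext x
    simp only [mem_inter_iff, mem_preimage, mem_singleton_iff]
    rw [hEa, hEb, show (a : ℂ) = p + v by rw [hv]; ring, show (b : ℂ) = p + w by rw [hw]; ring]
    have key := segment_inter_segment_eq_of_linearIndependent (p := (p : ℂ)) hind
    constructor
    · rintro ⟨h1, h2⟩
      have hx : (x : ℂ) ∈ segment ℝ (p : ℂ) (p + v) ∩ segment ℝ (p : ℂ) (p + w) := ⟨h1, h2⟩
      rw [key, mem_singleton_iff] at hx
      exact Subtype.ext hx
    · rintro rfl
      exact ⟨left_mem_segment ℝ _ _, left_mem_segment ℝ _ _⟩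
  · -- `c ∉ {a, b, p}`
    simp only [mem_insert_iff, mem_singleton_iff, not_or]
    refine ⟨fun h => ?_, fun h => hcb (congrArg Subtype.val h), fun h => ?_⟩
    · have h' : (c : ℂ) = a := congrArg Subtype.val h
      rw [hc] at h'
      exact hbp (by linear_combination h')
    · have h' : (c : ℂ) = p := congrArg Subtype.val h
      rw [hc] at h'
      have := (LinearIndependent.pair_iff.1 hind) 1 1 (by
        rw [one_smul, one_smul]; linear_combination h')
      simp at this
  · -- uniqueness of the fourth vertex
    rintro c' hc' ⟨S', hS', hc'S'⟩
    obtain ⟨E, hE, rfl⟩ := (hside _).1 hS'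
    obtain ⟨u₀, v₀, u₁, v₁, hu₀, hv₀, hu₁, hv₁, hneE, -, hAE⟩ :=
      sq_edge_image_eq_segment (A := A) hA hE
    have hendsE : A ⟨u₀, v₀⟩ ≠ A ⟨u₁, v₁⟩ := fun he => hneE (frame_mk_inj hind hA he)
    rw [Parallelograms.endpoints_eq_of_subset hU h𝒬 h𝒮 hendsE (hsegU hAE hE)] at hc'S'
    obtain ⟨-, hc'S'⟩ := hc'S'
    simp only [mem_preimage, mem_insert_iff, mem_singleton_iff] at hc'S'
    obtain ⟨xc, yc, hxc, hyc, hcc⟩ : ∃ xc yc : ℝ, (xc = 0 ∨ xc = 1) ∧ (yc = 0 ∨ yc = 1) ∧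
        (c' : ℂ) = A ⟨xc, yc⟩ := by
      rcases hc'S' with h | h
      · exact ⟨u₀, v₀, hu₀, hv₀, h⟩
      · exact ⟨u₁, v₁, hu₁, hv₁, h⟩
    simp only [mem_insert_iff, mem_singleton_iff, not_or] at hc'
    obtain ⟨hc'a, hc'b, hc'p⟩ := hc'
    apply Subtype.ext
    rcases hxc with rfl | rfl <;> rcases hyc with rfl | rfl
    · exact (hc'p (Subtype.ext (hcc.trans hA00))).elim
    · exact (hc'b (Subtype.ext (hcc.trans hA01))).elim
    · exact (hc'a (Subtype.ext (hcc.trans hA10))).elim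
    · exact hcc.trans hA11

/-- **[AbsTopIII] Prop 2.5 (e) ⇔ the parallelogram law near `p`.** For `U ⊆ ℂ` open,
`𝒮(U) ⊆ 𝒬 ⊆ 𝒫(U)`, granted the Prop 2.5 (c) reconstruction, and `p ∈ U`: there is `ε > 0` such that
for all `a, b ∈ U` within `ε` of `p` with `a, b ≠ p` and all `c ∈ U`,
`a +_p b = c` (`Parallelograms.LocalAdd 𝒬 p a b c`) **iff** `a − p`, `b − p` are `ℝ`-independent and
`c = a + b − p`.  ("Thus, '`a +_p b`' is defined for `a, b` in some neighborhood of `p` in `U`" —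
in general position; together with `p +_p b = b`, `a +_p p = a`.)
[cite: MochizukiAbsTopIII2015, Proposition 2.5 (e) p.57] -/
theorem Parallelograms.exists_nhds_localAdd_iff (hU : IsOpen U) {𝒬 : Set (Set U)}
    (h𝒬 : ∀ Q ∈ 𝒬, Subtype.val '' Q ∈ parallelogramsIn U)
    (h𝒮 : ∀ Q : Set U, Subtype.val '' Q ∈ squaresIn U → Q ∈ 𝒬)
    (H : Parallelograms.parallelograms 𝒬 = {P : Set U | Subtype.val '' P ∈ parallelogramsIn U})
    (p : U) :
    ∃ ε > 0, ∀ a b c : U, ‖(a : ℂ) - p‖ < ε → ‖(b : ℂ) - p‖ < ε → a ≠ p → b ≠ p →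
      (Parallelograms.LocalAdd 𝒬 p a b c ↔
        LinearIndependent ℝ ![(a : ℂ) - p, (b : ℂ) - p] ∧ (c : ℂ) = a + b - p) := by
  obtain ⟨ε, hε, hcl⟩ := exists_closure_openParallelogram_subset hU p.2
  refine ⟨ε, hε, fun a b c ha hb hap hbp => ⟨fun h => ?_, fun h => ?_⟩⟩
  · have := Parallelograms.coe_eq_of_localAdd hU h𝒬 h𝒮 H hap hbp h
    exact ⟨this.2, this.1⟩
  · exact Parallelograms.localAdd_of_linearIndependent hU h𝒬 h𝒮 H h.1 (hcl _ _ ha hb h.1) h.2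

end LocalAdd

end

end Literature.AnabelianGeometry.AbsoluteAnabelian
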